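import Summits.HodgeConjecture.HodgeConjecture.Cruxes.BlochSeedDiscOne.DepthBoundA4

/-!
# B3♭-KDLAW — Künneth-degree law and unit law for the door-(H2) back-channel of a box-line-bundle monad

hsemireg-monad-4 g28 (planner MECH, pen + typing), memo `Cruxes/BlochSeedDiscOne/B3FLAT-KDLAW-monad4-g28.md`.
D-0145 token: line stmt-HodgeConjecture-18881 `Cruxes/BlochSeedDiscOne/Lines/birth.lean` 814a6a70c14e831a
`stub_rung_pad4_seedAt` — stub untouched.  SPEC FILE (decidable letter predicates + their finite closed forms and the
formal inclusions between four door-(H2) censuses).  NOTHING here is proved toward HC ∕ HC_CM ∕ HC_AV ∕ №4 ∕ 26512 ∕ 18881 ∕ (H2):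
the analytic LAW «door (H2) ⇒ `RuleKD`» is a PEN statement of the memo (§1–§3) and appears below only as the docstring of
`RuleKD`, never as an axiom.  CENSUS-NEUTRAL: designs ≠ supports; class-alive ≠ Hall-passing ≠ monad ≠ SOURCE ≠ SEED.

## Setting (memo §1)
Three-term box-line-bundle monad `A —i→ N —q→ C` on `X = (E_i²)⁴`, display spectral sequence
`E₁^{p,q} = ⊕_{b−a=p} H^q(Hom(K^a,K^b)) ⇒ Ext^{p+q}(𝓔,𝓔)`.  LAW KD: along a chain `a → ν → c` (both arrows weakly live) the
`d₂`-image of a class of Künneth multidegree `d` (`|d| = 3`) in `Ext³(L_c, L_a)` has, at the three diagonal readings, components of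
multidegree `d − e_{f₀}` only, summed over the MOVING factor `f₀`; UNIT LAW: the `f₀`-term vanishes unless BOTH steps move on
`f₀`.  The block `(g,j)`, `g < j`, of a diagonal reading has multidegree `e_g + e_j`; so a chain un-closes block `(g,j)` iff
`∃ f₀`, both steps strict on `f₀`, with `e_g + e_j + e_{f₀}` available factorwise for the DOWN class `−(c − a)`
(EQUAL `{0,1,2}`, NULL `{1,2}`, AMPLE `{2}`; Mumford's index theorem, Kani for null classes; every key open).

## Contents (all sorry-free; `import` of the data model `DepthBoundA4` only; no `axiom` ∕ `instance` ∕ `unsafe` ∕ `native_decide`)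
§A type level — `avail`, `reach27` (availability, monad-4 g27 `h3mask`), `reach28` (availability ∧ unit law), `feasible3`
(monad-2 g7 `Feasible3` on chained pairs); `reach27_of_reach28`, `feasible3_of_reach27`, `feasible3_iff_exists_reach27_vec`
(RECONCILIATION: `Feasible3 ⇔ some block g<j available`), closed forms `reach27_eq_cf27`, `reach28_eq_cf28` (by `decide +kernel`
over the 3⁴·2⁴ patterns × 6 blocks), the S84 mechanism `reach27_false_of_offblock_moving`, the unit-law mechanism
`reach28_false_of_no_double_move`, worked examples.
§B letter level — `stepType`, `compType`, `strictPat`, `Channel`, `Avail`, `Feasible3W` over the tree's `Letter`∕`Cell`.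
§C design level — `Design3` and the door vocabulary `NullStep`∕`Supplies`∕`Detects` VERBATIM from `LeggedFloor.lean` ∕
`B3MonadDoors.lean` (inlined only because the farm snapshot had not built those modules when this file was checked,
`remote:stale:2:unbuilt:…B3MonadDoors`, 2026-08-30T22:5xZ; character-identical text, so every statement transports), then
`RuleD3` (g27, d₁ only) ⇒ `RuleKD` (THIS MEMO) ⇒ `Rule27` (g27 CLOSED-block door) ⇒ `RuleDM` (monad-2 g7 RULE Dᴹ):
`ruleKD_of_ruleD3`, `rule27_of_ruleKD`, `ruleDM_of_rule27`; contrapositively the census inclusions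
Dᴹ-rigorous-failing ⊆ CLOSED₂₇ ⊆ CLOSED₂₈ ⊆ RULE-D₃-failing of the engine `kdlaw.py`; `ruleKD_iff_ruleD3_of_C_nil`
(two-term designs: the law is RULE D of record); `ruleKD_of_ruleKDmin` (minimal displays, `Supplies` with `x ≠ y`).
-/

set_option linter.dupNamespace false
set_option autoImplicit false

namespace Summit.HodgeConjecture.HodgeConjecture.Cruxes.BlochSeedDiscOne.KunnethDegree

open DepthBoundA4

/-! ## §A  Type level -/

/-- Composite type of ONE factor of a weakly-live chain `a → ν → c`, read upwards (`c_f` versus `a_f`):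
`0` = EQUAL, `1` = NULL (isotropic, `a` increases), `2` = AMPLE.  The DOWN class `Hom(L_c,L_a)_f` is its negative. -/
abbrev FType := Fin 3

/-- Dolbeault degrees available to `Hom(L_c, L_a)_f ⊗ (any Pic⁰ key)` by composite type:
EQUAL `{0,1,2}` (key aligned), NULL-down `{1,2}`, AMPLE-down `{2}` (Mumford index theorem; Kani for null classes). -/
def avail (t : FType) (d : ℕ) : Bool :=
  (t == 0 && Nat.ble d 2) || (t == 1 && (d == 1 || d == 2)) || (t == 2 && d == 2)

/-- The Künneth multidegree `e_g + e_j + e_{f₀}` evaluated at factor `f`. -/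
def deg3 (g j f₀ f : Fin 4) : ℕ :=
  (if f = g then 1 else 0) + (if f = j then 1 else 0) + (if f = f₀ then 1 else 0)

/-- The four factors, as a list for Boolean folds. -/
def factors : List (Fin 4) := [0, 1, 2, 3]

/-- The six blocks `(g, j)`, `g < j`, of a diagonal reading (`H^{0,2}(X)` has the 24 mixed types `e_g + e_j`). -/
def blocks : List (Fin 4 × Fin 4) := [(0, 1), (0, 2), (0, 3), (1, 2), (1, 3), (2, 3)]

theorem mem_blocks_iff : ∀ g j : Fin 4, (g, j) ∈ blocks ↔ g < j := by decide

/-- AVAILABILITY (monad-4 g27 `h3mask`, every key open): block `(g,j)` is reachable along a chain of composite type `t`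
iff for SOME factor `f₀` (on-block allowed) the multidegree `e_g + e_j + e_{f₀}` is available factorwise. -/
def reach27 (t : Fin 4 → FType) (g j : Fin 4) : Bool :=
  factors.any fun f₀ => factors.all fun f => avail (t f) (deg3 g j f₀ f)

/-- CHANNEL (g28 = availability ∧ UNIT LAW): in addition BOTH steps of the chain move on the lowered factor `f₀`
(`s f₀ = true`, `s` = the strictness pattern of the chain). -/
def reach28 (t : Fin 4 → FType) (s : Fin 4 → Bool) (g j : Fin 4) : Bool :=
  factors.any fun f₀ => s f₀ && factors.all fun f => avail (t f) (deg3 g j f₀ f)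

/-- Lowest available degree of a type (`0, 1, 2`); the highest is always `2`. -/
def lo (t : FType) : ℕ := t.val

/-- monad-2 g7 `Feasible3` for a chained pair: some multidegree of total degree `3` is available,
i.e. `Σ lo ≤ 3 (≤ 8 = Σ hi)`. -/
def feasible3 (t : Fin 4 → FType) : Bool := Nat.ble (lo (t 0) + lo (t 1) + lo (t 2) + lo (t 3)) 3

theorem reach27_of_reach28 (t : Fin 4 → FType) (s : Fin 4 → Bool) (g j : Fin 4)
    (h : reach28 t s g j = true) : reach27 t g j = true := by
  simp only [reach28, reach27, List.any_eq_true, Bool.and_eq_true] at h ⊢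
  obtain ⟨f₀, hf, -, hall⟩ := h
  exact ⟨f₀, hf, hall⟩

/-- `Fin 4`-vector eta (to move between curried enumerations and functions). -/
theorem vec4_eta {α : Type} (t : Fin 4 → α) : ![t 0, t 1, t 2, t 3] = t := by
  funext f; fin_cases f <;> rfl

theorem feasible3_of_reach27_vec : ∀ (t₀ t₁ t₂ t₃ : FType) (g j : Fin 4),
    reach27 ![t₀, t₁, t₂, t₃] g j = true → feasible3 ![t₀, t₁, t₂, t₃] = true := by
  decide +kernel

theorem feasible3_of_reach27 (t : Fin 4 → FType) (g j : Fin 4) (h : reach27 t g j = true) :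
    feasible3 t = true := by
  have h' := feasible3_of_reach27_vec (t 0) (t 1) (t 2) (t 3) g j
  rw [vec4_eta t] at h'
  exact h' h

/-- RECONCILIATION at type level (memo §3.3): monad-2's `Feasible3` holds iff SOME block `g < j` is available in g27's sense —
so RULE Dᴹ's «contaminated cell» is exactly «some block of the cell has a g27-escape through some chain». -/
theorem feasible3_iff_exists_reach27_vec : ∀ (t₀ t₁ t₂ t₃ : FType),
    feasible3 ![t₀, t₁, t₂, t₃] = true ↔ ∃ g j : Fin 4, g < j ∧ reach27 ![t₀, t₁, t₂, t₃] g j = true := by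
  decide +kernel

theorem exists_reach27_of_feasible3 (t : Fin 4 → FType) (h : feasible3 t = true) :
    ∃ g j : Fin 4, g < j ∧ reach27 t g j = true := by
  have h' := (feasible3_iff_exists_reach27_vec (t 0) (t 1) (t 2) (t 3)).1
  rw [vec4_eta t] at h'
  exact h' h

/-- Both OFF-block factors are EQUAL composites. -/
def offEq (t : Fin 4 → FType) (g j : Fin 4) : Bool :=
  factors.all fun f => f == g || f == j || t f == 0

/-- CLOSED FORM of availability for a block `g < j` (memo §3.2): EITHER the chain is constant off the block and the two block
legs are not both AMPLE (`f₀` on the block), OR it is constant on one off-block factor, of type ≠ AMPLE on the other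
(`f₀` = that factor; NULL in every realised chain) and both block legs are non-AMPLE. -/
def cf27 (t : Fin 4 → FType) (g j : Fin 4) : Bool :=
  (offEq t g j && !(t g == 2 && t j == 2)) ||
  (factors.any fun o => !(o == g) && !(o == j) && !(t o == 2) && !(t g == 2) && !(t j == 2) &&
      factors.all fun f => f == g || f == j || f == o || t f == 0)

/-- CLOSED FORM of the channel criterion (memo §3.2): as `cf27`, with the lowered factor `f₀` DOUBLY MOVED:
(i) constant off the block, both steps move on a block leg whose partner leg is non-AMPLE; or
(ii) constant on one off-block factor, both steps move on the other (non-AMPLE, hence two parallel NULL steps), block legs non-AMPLE. -/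
def cf28 (t : Fin 4 → FType) (s : Fin 4 → Bool) (g j : Fin 4) : Bool :=
  (offEq t g j && ((s g && !(t j == 2)) || (s j && !(t g == 2)))) ||
  (factors.any fun o => !(o == g) && !(o == j) && s o && !(t o == 2) && !(t g == 2) && !(t j == 2) &&
      factors.all fun f => f == g || f == j || f == o || t f == 0)

theorem reach27_eq_cf27 : ∀ (t₀ t₁ t₂ t₃ : FType) (g j : Fin 4), (g, j) ∈ blocks →
    reach27 ![t₀, t₁, t₂, t₃] g j = cf27 ![t₀, t₁, t₂, t₃] g j := by
  decide +kernel

theorem reach28_eq_cf28 : ∀ (t₀ t₁ t₂ t₃ : FType) (s₀ s₁ s₂ s₃ : Bool) (g j : Fin 4), (g, j) ∈ blocks →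
    reach28 ![t₀, t₁, t₂, t₃] ![s₀, s₁, s₂, s₃] g j = cf28 ![t₀, t₁, t₂, t₃] ![s₀, s₁, s₂, s₃] g j := by
  decide +kernel

/-- S84 MECHANISM (memo §4.1; the 48 CLOSED C-cells of ac808a66 ∕ 08162ddb, block `(0,3)`, chains of types ENNE ∕ ENNN ∕ NNNE ∕ …):
if BOTH off-block factors carry a non-EQUAL composite, the block is not even available (each moved factor demands a unit of
degree and `|e_g + e_j + e_{f₀}|` has only one to spare). -/
theorem reach27_false_of_offblock_moving : ∀ (t₀ t₁ t₂ t₃ : FType) (g j : Fin 4), (g, j) ∈ blocks →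
    (factors.all fun f => f == g || f == j || !(![t₀, t₁, t₂, t₃] f == 0)) = true →
    reach27 ![t₀, t₁, t₂, t₃] g j = false := by
  decide +kernel

/-- UNIT-LAW MECHANISM (memo §4.2; e.g. the B2SURV×12 A-cell `((10;−2,0),(12;0,0),(12;0,0),(9;−3,0))`, whose only chain has type
NEEN with `i` moving factor 0 alone and `q` moving factor 3 alone): a chain in which NO factor is moved by both steps channels
nothing, whatever its availability. -/
theorem reach28_false_of_no_double_move (t : Fin 4 → FType) (g j : Fin 4) :
    reach28 t (fun _ => false) g j = false := rfl

/-- Worked example (memo §3.3): the composite type (A,E,E,N) is `Feasible3` (so RULE Dᴹ exempts every block of all three cells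
of such a chain) but makes ONLY the block `(0,3)` available. -/
example : feasible3 ![2, 0, 0, 1] = true ∧ reach27 ![2, 0, 0, 1] 0 3 = true ∧
    ∀ g j : Fin 4, g < j → reach27 ![2, 0, 0, 1] g j = true → g = 0 ∧ j = 3 := by
  decide +kernel

/-- S84 ac808a66, C-cell `((11;0,−3),(13;0,−1),(13;0,−1),(14;0,0))`: its four chains have composite types ENNE, ENNN, ENNE, NNNE,
none of which makes `(0,3)` available (factors `1, 2` both NULL); by contrast ENEN (a chain of the sister cell with legs `2 ↔ 3`
swapped) does make `(0,3)` available — there the closed block is `(0,2)`. -/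
example : reach27 ![0, 1, 1, 0] 0 3 = false ∧ reach27 ![0, 1, 1, 1] 0 3 = false ∧
    reach27 ![1, 1, 1, 0] 0 3 = false ∧ reach27 ![0, 1, 0, 1] 0 3 = true ∧ reach27 ![0, 1, 0, 1] 0 2 = false := by
  decide +kernel

/-- WNSH2L A-cell `((13;−1,0),(13;−1,0),(13;0,1),(13;0,1))`, block `(0,2)`: the chain of type NENN makes it AVAILABLE (g27 escape)
but moves no factor twice, so it is no CHANNEL (g28 closure by the unit law alone). -/
example : reach27 ![1, 0, 1, 1] 0 2 = true ∧ reach28 ![1, 0, 1, 1] ![false, false, false, false] 0 2 = false := by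
  decide +kernel

/-- Case (ii) of `cf28`: block `(0,3)` (off-block factors `1, 2`), composite type (N,N,E,E): the chain channels `(0,3)` when the
off-block NULL factor `1` is DOUBLY moved (two parallel null steps), and does not when only the block leg `0` is
(then `f₀ = 0` would need degree `2·e_0 + e_3`, unavailable on the NULL factor `1`). -/
example : reach28 ![1, 1, 0, 0] ![false, true, false, false] 0 3 = true ∧
    reach28 ![1, 1, 0, 0] ![true, false, false, false] 0 3 = false := by
  decide +kernel

/-! ## §B  Letter level (over the tree's `Letter` ∕ `Cell`) -/

/-- Step ∕ composite type of a factor pair read upwards `ℓ → ℓ′`: EQUAL `0`, NULL `1` (`|Δβ|² = Δa²`), else `2`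
(AMPLE on not-dead pairs; the value on dead pairs is never used: chains are weakly live). -/
def stepType (ℓ ℓ' : Letter) : FType :=
  if ℓ = ℓ' then 0
  else if (ℓ'.x - ℓ.x) ^ 2 + (ℓ'.y - ℓ.y) ^ 2 = (ℓ'.a - ℓ.a) ^ 2 then 1 else 2

/-- Composite type vector of the chain ends `a` (A-cell) and `c` (C-cell). -/
def compType (a c : Cell) : Fin 4 → FType := fun f => stepType (a f) (c f)

/-- Strictness pattern of the chain `a → ν → c`: BOTH steps move on factor `f`. -/
def strictPat (a ν c : Cell) : Fin 4 → Bool := fun f => decide (a f ≠ ν f ∧ ν f ≠ c f)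

/-- CHANNEL of the chain `a → ν → c` into the block `(g,j)` of its three diagonal readings (LAW KD + UNIT LAW, every key open). -/
def Channel (a ν c : Cell) (g j : Fin 4) : Prop := reach28 (compType a c) (strictPat a ν c) g j = true

/-- AVAILABILITY of block `(g,j)` along `a … c` (monad-4 g27's escape test, no unit law). -/
def Avail (a c : Cell) (g j : Fin 4) : Prop := reach27 (compType a c) g j = true

/-- monad-2 g7's `Feasible3 c a` on a chained (weakly live) pair. -/
def Feasible3W (c a : Cell) : Prop := feasible3 (compType a c) = true

theorem avail_of_channel (a ν c : Cell) (g j : Fin 4) (h : Channel a ν c g j) : Avail a c g j :=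
  reach27_of_reach28 _ _ g j h

theorem feasible3W_of_avail (a c : Cell) (g j : Fin 4) (h : Avail a c g j) : Feasible3W c a :=
  feasible3_of_reach27 _ g j h

theorem strictPat_self_left (a c : Cell) : strictPat a a c = fun _ => false := by
  funext f; simp [strictPat]

theorem strictPat_self_right (a ν : Cell) : strictPat a ν ν = fun _ => false := by
  funext f; simp [strictPat]

/-- Minimal-display rider for free: a chain with a SELF step (`a = ν` or `ν = c` as cells) channels nothing. -/
theorem not_channel_self_left (a c : Cell) (g j : Fin 4) : ¬ Channel a a c g j := by
  unfold Channel; rw [strictPat_self_left, reach28_false_of_no_double_move]; exact Bool.false_ne_true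

theorem not_channel_self_right (a ν : Cell) (g j : Fin 4) : ¬ Channel a ν ν g j := by
  unfold Channel; rw [strictPat_self_right, reach28_false_of_no_double_move]; exact Bool.false_ne_true

/-! ## §C  Design level -/

/-! ### The door-(H2) vocabulary of record, VERBATIM (`LeggedFloor.lean` ∕ `B3MonadDoors.lean`) -/

/-- NULL step on one factor: `a < a′` and `|β′ − β|² = (a′ − a)²`. -/
def NullStep (ℓ ℓ' : Letter) : Prop :=
  ℓ.a < ℓ'.a ∧ (ℓ'.x - ℓ.x) ^ 2 + (ℓ'.y - ℓ.y) ^ 2 = (ℓ'.a - ℓ.a) ^ 2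

/-- SUPPLIER PAIR for the block `(g, j)`: equal off `{g, j}`, and on each of `g`, `j` either EQUAL or a NULL step. -/
def Supplies (x y : Cell) (g j : Fin 4) : Prop :=
  (∀ f : Fin 4, f ≠ g → f ≠ j → x f = y f) ∧
    (x g = y g ∨ NullStep (x g) (y g)) ∧ (x j = y j ∨ NullStep (x j) (y j))

/-- Minimal-display supplier (monad-2 g7 §4 «noself»): a supplier that is a DIFFERENT cell. -/
def SuppliesStrict (x y : Cell) (g j : Fin 4) : Prop := x ≠ y ∧ Supplies x y g j

/-- The `(g, j)` block of `ob_κ(c)` is nonzero for some `κ ∈ T_W`: NOT (`β_g = β_j = 0` and `a_g = a_j`). -/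
def Detects (c : Cell) (g j : Fin 4) : Prop :=
  ¬ ((c g).x = 0 ∧ (c g).y = 0 ∧ (c j).x = 0 ∧ (c j).y = 0 ∧ (c g).a = (c j).a)

/-- A three-term letter design `A —i→ N —q→ C` (cells with multiplicities; entries with multiplicity `0` are ignored). -/
structure Design3 where
  A : List (Cell × ℕ)
  N : List (Cell × ℕ)
  C : List (Cell × ℕ)

namespace Design3

/-- Supported A-cells. -/
def suppA (D : Design3) : List Cell := (D.A.filter fun cm => 0 < cm.2).map Prod.fst
/-- Supported N-cells. -/
def suppN (D : Design3) : List Cell := (D.N.filter fun cm => 0 < cm.2).map Prod.fst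
/-- Supported C-cells. -/
def suppC (D : Design3) : List Cell := (D.C.filter fun cm => 0 < cm.2).map Prod.fst

theorem suppC_eq_nil_of_C_nil (D : Design3) (hC : D.C = []) : D.suppC = [] := by
  simp [suppC, hC]

end Design3

/-! ### Escapes, and the four doors -/

/-- g28 escape of an A-cell: a weakly-live chain `a → ν → c` with a CHANNEL into block `(g,j)`. -/
def EscA (D : Design3) (a : Cell) (g j : Fin 4) : Prop :=
  ∃ ν ∈ D.suppN, ∃ c ∈ D.suppC, WeakLive a ν ∧ WeakLive ν c ∧ Channel a ν c g j
/-- g28 escape of an N-cell. -/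
def EscN (D : Design3) (ν : Cell) (g j : Fin 4) : Prop :=
  ∃ a ∈ D.suppA, ∃ c ∈ D.suppC, WeakLive a ν ∧ WeakLive ν c ∧ Channel a ν c g j
/-- g28 escape of a C-cell. -/
def EscC (D : Design3) (c : Cell) (g j : Fin 4) : Prop :=
  ∃ a ∈ D.suppA, ∃ ν ∈ D.suppN, WeakLive a ν ∧ WeakLive ν c ∧ Channel a ν c g j

/-- g27 escape of an A-cell: AVAILABILITY only (no unit law). -/
def Esc27A (D : Design3) (a : Cell) (g j : Fin 4) : Prop :=
  ∃ ν ∈ D.suppN, ∃ c ∈ D.suppC, WeakLive a ν ∧ WeakLive ν c ∧ Avail a c g j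
/-- g27 escape of an N-cell. -/
def Esc27N (D : Design3) (ν : Cell) (g j : Fin 4) : Prop :=
  ∃ a ∈ D.suppA, ∃ c ∈ D.suppC, WeakLive a ν ∧ WeakLive ν c ∧ Avail a c g j
/-- g27 escape of a C-cell. -/
def Esc27C (D : Design3) (c : Cell) (g j : Fin 4) : Prop :=
  ∃ a ∈ D.suppA, ∃ ν ∈ D.suppN, WeakLive a ν ∧ WeakLive ν c ∧ Avail a c g j

/-- RULE D₃ (monad-4 g27, d₁ channel only; same text as `MonadDoors.RuleD3`, clauses N ∧ A ∧ C). -/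
def RuleD3 (D : Design3) : Prop :=
  (∀ n ∈ D.suppN, ∀ g j : Fin 4, g < j → Detects n g j →
      (∃ a ∈ D.suppA, Supplies a n g j) ∨ (∃ c ∈ D.suppC, Supplies n c g j)) ∧
  (∀ a ∈ D.suppA, ∀ g j : Fin 4, g < j → Detects a g j → ∃ n ∈ D.suppN, Supplies a n g j) ∧
  (∀ c ∈ D.suppC, ∀ g j : Fin 4, g < j → Detects c g j → ∃ n ∈ D.suppN, Supplies n c g j)

/-- RULE KD — THE DOOR OF THIS MEMO (door (H2) at letter level under LAW KD + UNIT LAW, every key open): every detecting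
block of every supported cell is d₁-SUPPLIED by a term-adjacent cell, or has a d₂-CHANNEL.  LAW (pen, memo §1–§3): for every
holomorphic three-term box-line-bundle monad on `E⁴` realising `D` (any Pic⁰ labelling, any maps), door (H2) ⇒ `RuleKD D`;
a violated clause names a CLOSED block `(v; g, j)` and a `κ ∈ T_W` with `ob_κ(𝓔) ≠ 0`. -/
def RuleKD (D : Design3) : Prop :=
  (∀ a ∈ D.suppA, ∀ g j : Fin 4, g < j → Detects a g j → (∃ n ∈ D.suppN, Supplies a n g j) ∨ EscA D a g j) ∧
  (∀ n ∈ D.suppN, ∀ g j : Fin 4, g < j → Detects n g j →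
      (∃ a ∈ D.suppA, Supplies a n g j) ∨ (∃ c ∈ D.suppC, Supplies n c g j) ∨ EscN D n g j) ∧
  (∀ c ∈ D.suppC, ∀ g j : Fin 4, g < j → Detects c g j → (∃ n ∈ D.suppN, Supplies n c g j) ∨ EscC D c g j)

/-- RULE KD for MINIMAL displays (monad-2 g7 §4 rider: self-suppliers carry zero maps; channels need no change, see
`not_channel_self_left/right`). -/
def RuleKDmin (D : Design3) : Prop :=
  (∀ a ∈ D.suppA, ∀ g j : Fin 4, g < j → Detects a g j → (∃ n ∈ D.suppN, SuppliesStrict a n g j) ∨ EscA D a g j) ∧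
  (∀ n ∈ D.suppN, ∀ g j : Fin 4, g < j → Detects n g j →
      (∃ a ∈ D.suppA, SuppliesStrict a n g j) ∨ (∃ c ∈ D.suppC, SuppliesStrict n c g j) ∨ EscN D n g j) ∧
  (∀ c ∈ D.suppC, ∀ g j : Fin 4, g < j → Detects c g j → (∃ n ∈ D.suppN, SuppliesStrict n c g j) ∨ EscC D c g j)

/-- RULE 27 — monad-4 g27's CLOSED-block door (`diagbudget.py` §4): supplied or AVAILABLE along some chain. -/
def Rule27 (D : Design3) : Prop :=
  (∀ a ∈ D.suppA, ∀ g j : Fin 4, g < j → Detects a g j → (∃ n ∈ D.suppN, Supplies a n g j) ∨ Esc27A D a g j) ∧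
  (∀ n ∈ D.suppN, ∀ g j : Fin 4, g < j → Detects n g j →
      (∃ a ∈ D.suppA, Supplies a n g j) ∨ (∃ c ∈ D.suppC, Supplies n c g j) ∨ Esc27N D n g j) ∧
  (∀ c ∈ D.suppC, ∀ g j : Fin 4, g < j → Detects c g j → (∃ n ∈ D.suppN, Supplies n c g j) ∨ Esc27C D c g j)

/-- BAD triple (monad-2 g7 §1.4) on a chained pair. -/
def Bad (a ν c : Cell) : Prop := WeakLive a ν ∧ WeakLive ν c ∧ Feasible3W c a
/-- CLEAN A-cell: on no bad triple. -/
def CleanA (D : Design3) (a : Cell) : Prop := ¬ ∃ ν ∈ D.suppN, ∃ c ∈ D.suppC, Bad a ν c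
/-- CLEAN N-cell. -/
def CleanN (D : Design3) (ν : Cell) : Prop := ¬ ∃ a ∈ D.suppA, ∃ c ∈ D.suppC, Bad a ν c
/-- CLEAN C-cell. -/
def CleanC (D : Design3) (c : Cell) : Prop := ¬ ∃ a ∈ D.suppA, ∃ ν ∈ D.suppN, Bad a ν c

/-- RULE Dᴹ (monad-2 g7 §2, verbatim structure; director R19.626: the door-(H2) column for three-term designs):
CLEAN cells must be d₁-supplied; contaminated cells are exempt. -/
def RuleDM (D : Design3) : Prop :=
  (∀ a ∈ D.suppA, CleanA D a → ∀ g j : Fin 4, g < j → Detects a g j → ∃ ν ∈ D.suppN, Supplies a ν g j) ∧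
  (∀ c ∈ D.suppC, CleanC D c → ∀ g j : Fin 4, g < j → Detects c g j → ∃ ν ∈ D.suppN, Supplies ν c g j) ∧
  (∀ ν ∈ D.suppN, CleanN D ν → ∀ g j : Fin 4, g < j → Detects ν g j →
      (∃ a ∈ D.suppA, Supplies a ν g j) ∨ (∃ c ∈ D.suppC, Supplies ν c g j))

/-! ### The inclusions
The chain of record is `RuleD3 ⇒ RuleKD ⇒ Rule27 ⇒ RuleDM`, and `RuleKDmin ⇒ RuleKD`; contrapositively (engine columns of
`kdlaw.py`): Dᴹ-rigorous-failing ⊆ CLOSED₂₇ ⊆ CLOSED₂₈ ⊆ RULE-D₃-failing, and CLOSED₂₈ ⊆ CLOSED₂₈-noself. -/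

theorem ruleKD_of_ruleD3 (D : Design3) (h : RuleD3 D) : RuleKD D := by
  obtain ⟨hN, hA, hC⟩ := h
  refine ⟨?_, ?_, ?_⟩
  · intro a ha g j hgj hd
    exact Or.inl (hA a ha g j hgj hd)
  · intro n hn g j hgj hd
    rcases hN n hn g j hgj hd with h | h
    · exact Or.inl h
    · exact Or.inr (Or.inl h)
  · intro c hc g j hgj hd
    exact Or.inl (hC c hc g j hgj hd)

theorem ruleKD_of_ruleKDmin (D : Design3) (h : RuleKDmin D) : RuleKD D := by
  obtain ⟨hA, hN, hC⟩ := h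
  refine ⟨?_, ?_, ?_⟩
  · intro a ha g j hgj hd
    rcases hA a ha g j hgj hd with ⟨n, hn, hs⟩ | h
    · exact Or.inl ⟨n, hn, hs.2⟩
    · exact Or.inr h
  · intro n hn g j hgj hd
    rcases hN n hn g j hgj hd with ⟨a, ha, hs⟩ | ⟨c, hc, hs⟩ | h
    · exact Or.inl ⟨a, ha, hs.2⟩
    · exact Or.inr (Or.inl ⟨c, hc, hs.2⟩)
    · exact Or.inr (Or.inr h)
  · intro c hc g j hgj hd
    rcases hC c hc g j hgj hd with ⟨n, hn, hs⟩ | h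
    · exact Or.inl ⟨n, hn, hs.2⟩
    · exact Or.inr h

theorem esc27A_of_escA (D : Design3) (a : Cell) (g j : Fin 4) (h : EscA D a g j) : Esc27A D a g j := by
  obtain ⟨ν, hν, c, hc, h1, h2, h3⟩ := h
  exact ⟨ν, hν, c, hc, h1, h2, avail_of_channel a ν c g j h3⟩

theorem esc27N_of_escN (D : Design3) (ν : Cell) (g j : Fin 4) (h : EscN D ν g j) : Esc27N D ν g j := by
  obtain ⟨a, ha, c, hc, h1, h2, h3⟩ := h
  exact ⟨a, ha, c, hc, h1, h2, avail_of_channel a ν c g j h3⟩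

theorem esc27C_of_escC (D : Design3) (c : Cell) (g j : Fin 4) (h : EscC D c g j) : Esc27C D c g j := by
  obtain ⟨a, ha, ν, hν, h1, h2, h3⟩ := h
  exact ⟨a, ha, ν, hν, h1, h2, avail_of_channel a ν c g j h3⟩

theorem rule27_of_ruleKD (D : Design3) (h : RuleKD D) : Rule27 D := by
  obtain ⟨hA, hN, hC⟩ := h
  refine ⟨?_, ?_, ?_⟩
  · intro a ha g j hgj hd
    rcases hA a ha g j hgj hd with hs | he
    · exact Or.inl hs
    · exact Or.inr (esc27A_of_escA D a g j he)
  · intro n hn g j hgj hd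
    rcases hN n hn g j hgj hd with hs | hs | he
    · exact Or.inl hs
    · exact Or.inr (Or.inl hs)
    · exact Or.inr (Or.inr (esc27N_of_escN D n g j he))
  · intro c hc g j hgj hd
    rcases hC c hc g j hgj hd with hs | he
    · exact Or.inl hs
    · exact Or.inr (esc27C_of_escC D c g j he)

theorem ruleDM_of_rule27 (D : Design3) (h : Rule27 D) : RuleDM D := by
  obtain ⟨hA, hN, hC⟩ := h
  refine ⟨?_, ?_, ?_⟩
  · intro a ha hclean g j hgj hd
    rcases hA a ha g j hgj hd with hs | ⟨ν, hν, c, hc, h1, h2, h3⟩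
    · exact hs
    · exact absurd ⟨ν, hν, c, hc, h1, h2, feasible3W_of_avail a c g j h3⟩ hclean
  · intro c hc hclean g j hgj hd
    rcases hC c hc g j hgj hd with hs | ⟨a, ha, ν, hν, h1, h2, h3⟩
    · exact hs
    · exact absurd ⟨a, ha, ν, hν, h1, h2, feasible3W_of_avail a c g j h3⟩ hclean
  · intro ν hν hclean g j hgj hd
    rcases hN ν hν g j hgj hd with hs | hs | ⟨a, ha, c, hc, h1, h2, h3⟩
    · exact Or.inl hs
    · exact Or.inr hs
    · exact absurd ⟨a, ha, c, hc, h1, h2, feasible3W_of_avail a c g j h3⟩ hclean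

/-- The whole chain, for the record: RULE D₃ ⇒ RULE Dᴹ via RULE KD and RULE 27. -/
theorem ruleDM_of_ruleD3 (D : Design3) (h : RuleD3 D) : RuleDM D :=
  ruleDM_of_rule27 D (rule27_of_ruleKD D (ruleKD_of_ruleD3 D h))

/-- Two-term designs (`C = []`): no column `−2`, no chain — RULE KD is RULE D₃ (= RULE D of record for `E = coker(A → N)`). -/
theorem ruleKD_iff_ruleD3_of_C_nil (D : Design3) (hC : D.C = []) : RuleKD D ↔ RuleD3 D := by
  have hs := Design3.suppC_eq_nil_of_C_nil D hC
  constructor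
  · rintro ⟨hA, hN, -⟩
    refine ⟨?_, ?_, ?_⟩
    · intro n hn g j hgj hd
      rcases hN n hn g j hgj hd with h | h | ⟨a, _, c, hc, _⟩
      · exact Or.inl h
      · exact Or.inr h
      · simp [hs] at hc
    · intro a ha g j hgj hd
      rcases hA a ha g j hgj hd with h | ⟨ν, _, c, hc, _⟩
      · exact h
      · simp [hs] at hc
    · intro c hc
      simp [hs] at hc
  · exact ruleKD_of_ruleD3 D

end Summit.HodgeConjecture.HodgeConjecture.Cruxes.BlochSeedDiscOne.KunnethDegree
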